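import Summits.HodgeConjecture.HodgeConjecture.Theorems.HeckePrymWeilHeckePrymAnchorsOfCoreFacts
import Literature.AlgebraicGeometry.HodgeTheory.WeilFamilyGlobalAction
import HarnessLib

/-!
# `HeckePrymAnchors` modulo Voisin II Thm. 4.18 (`ℚ`-form) and Deligne's abelian scheme with `K`-action (item stmt-HodgeConjecture-14496, route HeckePrymWeil)

Line `Sketch`, v13 (continuation lead c8): the crux `HeckePrymAnchors` of route `HeckePrymWeil`
derived from the two named facts registered as the stubs of the line's skeleton
(`Cruxes/HeckePrymAnchors/Lines/Sketch.lean`: `stub_fact_voisin`, `stub_weilFamilyCore`):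

* `Motives.Voisin2003_invariantCycles` (`Motives/FlatSubfamily`; Deligne 1968 Prop. (2.1) +
  (2.6.3) = Voisin II Thm. 4.18: global sections of `Rⁿ f_* ℚ` of a smooth projective `f` come
  from the total space);
* `HodgeTheory.deligne1982_weilFamily_globalAction` (`HodgeTheory/WeilFamilyGlobalAction`;
  [Deligne1982HodgeCycles], proof of Thm. 4.8, p. 48, clauses (a)–(c), and p. 50: the abelian
  scheme with `E`-action through `X`, all fibres of balanced Weil type, a CM/tensor fibre, and the
  flatness of the Weil class) — the CONSTRUCTION-NATIVE core of the earlier blocker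
  `deligne1982_weilFamily_hodgeWeilSection`, which it implies by the tree's THEOREM
  `deligne1982_weilFamily_hodgeWeilSection_of_globalAction` (transport commutes with the global
  `√-p` and with cup products, so the Weil planes form a sub-local system; the fibrewise typing and
  the Weil-plane membership at the special fibre are no longer part of the debt).

The proof is the composition of that theorem with the landed
`heckePrymAnchors_of_voisin2003_of_weilFamily` (`Theorems/HeckePrymWeilHeckePrymAnchorsOfCoreFacts`,
p116201). No `sorry`, no definition, no new axiom.
-/

noncomputable section

-- every declaration of this problem lives in `Summit.HodgeConjecture.HodgeConjecture.…` (summit = sub-problem)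
set_option linter.dupNamespace false

open CategoryTheory AlgebraicGeometry Limits MonoidalCategory CartesianMonoidalCategory

namespace Summit.HodgeConjecture.HodgeConjecture.Theorems.HeckePrymWeilLine

open Literature.AlgebraicGeometry Literature.AlgebraicGeometry.Motives Literature.AlgebraicGeometry.HodgeTheory
open Summit.HodgeConjecture.HodgeConjecture.Theses.HeckePrymWeil

/-- **`HeckePrymAnchors` from Voisin II Thm. 4.18 (`ℚ`-form) and Deligne's abelian scheme with
`K`-action.** The crux of route `HeckePrymWeil` follows from the two named facts
`Motives.Voisin2003_invariantCycles` and `HodgeTheory.deligne1982_weilFamily_globalAction`: the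
latter gives the fibrewise-Hodge flat Weil section package
(`deligne1982_weilFamily_hodgeWeilSection_of_globalAction`, proved in the tree), and the landed
closure `heckePrymAnchors_of_voisin2003_of_weilFamily` concludes.
[cite: Deligne1982HodgeCycles, proof of Thm. 4.8 (pp. 47–52) with Prop. 4.4]
[cite: VoisinHodgeII2003, Thm. 4.18 (with Thm. 4.15, Lemma 4.17)] -/
theorem heckePrymAnchors_of_voisin2003_of_globalAction :
    (Voisin2003_invariantCycles) → (deligne1982_weilFamily_globalAction) → Summit.HodgeConjecture.HodgeConjecture.Theses.HeckePrymWeil.HeckePrymAnchors :=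
  fun hV hGA =>
    heckePrymAnchors_of_voisin2003_of_weilFamily hV
      (deligne1982_weilFamily_hodgeWeilSection_of_globalAction hGA)

end Summit.HodgeConjecture.HodgeConjecture.Theorems.HeckePrymWeilLine

end
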